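import Literature.Topology.FourManifolds.FlowerSymmetry
import Literature.Topology.FourManifolds.PlanarDoubleRetraction
import HarnessLib

/-!
# A sector of the flower surface deformation retracts onto a wedge of two circles

Topic `Literature/Topology/FourManifolds`; fact seat
`provefact-Literature.Topology.FourManifolds.exists-cbed50d78a` (named fact (g′)
`Literature.Topology.FourManifolds.exists_marking_centralSurface_of_gkTrisection`), sequel of
`FlowerHandlebody.lean` (the explicit genus-`g` handlebody `{q_g + z² ≤ c_g}`, `g ≥ 2`),
`FlowerDomainPolar.lean` (the flower domain `D = {q_g ≤ c_g}` in polar coordinates: floor `θ_lo`,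
radii `ρ₁ < 7^{1/20g} < ρ₃ < ρ₄`) and `PlanarDoubleRetraction.lean` (the double
`Z = {q + z² = c}` and the lifting of seam-fixing planar deformations).  Towards the marking of the
flower surface `Z` (`FlowerModel.flowerSurface`) by the surface group `S_g` (Hatcher, §1.2 p. 51)
we decompose `Z` into the `g` congruent **sectors** over the wedges of `D` between consecutive
valley rays; this file proves that **one sector strong deformation retracts onto a wedge of two
circles** — the lens curve `L` (boundary of the hole) and the circle `m⁺ ∪ m⁻` over the segment
`m = [7^{1/20g}, ρ₃]` of the peak ray — explicitly:

* §1 the reflection `refl` (complex conjugation; `q ∘ refl = q`) and the wedge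
  `W = D ∩ {|arg| ≤ π/g} = W₊ ∪ refl(W₊)` (`FlowerModel.wedge`; compact);
* §2 the **floor squeeze** on the half-wedge `W₊`: `(r, θ) ↦ (r, θ_lo(r) + (1-t)(θ - θ_lo(r)))`
  (`FlowerModel.sqz`, written with `‖p‖` and `arg`): it maps `W₊` into itself, is the identity at
  `t = 0`, lands on the floor `{pol r (θ_lo r)}` at `t = 1`, fixes the floor — in particular the
  seam `W₊ ∩ {q = c}`, which lies on the floor by the seam criterion — and is continuous on
  `ℝ × W₊` (at the origin because it preserves the norm, elsewhere because `arg` is continuous on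
  the slit plane);
* §3 the squeeze on the whole wedge (`FlowerModel.sqzW`, conjugated by `refl` on the lower half;
  the two agree on the axis, which is fixed), continuous by pasting the two closed halves;
* §4 the **axis slide** on the floor set (`FlowerModel.slide`): the axis segment `[0, ρ₁]` slides
  into the inner pinch point `(ρ₁, 0)`, the rest of the floor (the *spine floor*: lens branches,
  `m`, outer arcs, `FlowerModel.spineFloor`) staying fixed;
* §5 lifting both to the double (`PlanarDouble.isStrongDeformationRetractOf_double`) and composing
  (`IsStrongDeformationRetractOf.trans`): **the sector `Z ∩ π⁻¹(W)` (`FlowerModel.sectorZ`)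
  strong deformation retracts onto its spine `Z ∩ π⁻¹(spine floor)`** (`FlowerModel.spineZ`:
  `L ∪ m⁺ ∪ m⁻ ∪ O`, `O` the outer boundary arc of the wedge);
* §6 the **whisker collapse** (`FlowerModel.whisker`): `O` slides along itself into the indentation
  point `Q = (ρ₃, 0, 0)` (`FlowerModel.ptQ`), whence the sector strong deformation retracts onto
  the reduced spine `L ∪ m⁺ ∪ m⁻` (`FlowerModel.spineZ'`,
  `spineZ'_isStrongDeformationRetractOf_sectorZ`), a wedge of two circles at the lens tip
  `P = (7^{1/20g}, 0, 0)`.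

The sequel puts a ball around `P`, presents the reduced spine as a ball with two arcs, and reads
off `π₁(sector) ≅ F₂` with the boundary circle of the sector a commutator.  Everything here is
proved; no named facts.

## References

* A. Hatcher, *Algebraic Topology*, CUP (2002), Ch. 0 p. 2 (deformation retractions), §1.2 p. 51
  (`π₁(Σ_g)`). [HatcherAT2002]
* D. Gay, R. Kirby, *Trisecting 4-manifolds*, Geom. Topol. 20 (2016), Def. 1, Remark 2.
  [GayKirby2016]
-/

open scoped Manifold ContDiff Topology InnerProductSpace Real
open Set Function Filter Metric Module Complex

noncomputable section

namespace Literature.Topology.FourManifolds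

/-- Local notation: `𝔼 n` is the model Euclidean space `EuclideanSpace ℝ (Fin n)`. -/
local notation "𝔼 " n:arg => EuclideanSpace ℝ (Fin n)

open PlanarThickening PlanarDouble Literature.AlgebraicTopology.Homotopy

namespace FlowerModel

variable {g : ℕ}

/-! ### §1 The full wedge -/

variable (g) in
/-- **The wedge**: the part of the flower domain between two consecutive valley rays,
`{q ≤ c} ∩ {|arg| ≤ π/g}`. [folklore] -/
def wedge : Set (𝔼 2) := {p | flower g p ≤ level g ∧ |Complex.arg (toC p)| ≤ π / g}

/-- The upper half of the wedge is the half-wedge. [folklore] -/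
theorem wedge_inter_im_nonneg : wedge g ∩ {p | 0 ≤ (toC p).im} = halfWedge g := by
  ext p
  simp only [wedge, halfWedge, mem_inter_iff, mem_setOf_eq, abs_le]
  constructor
  · rintro ⟨⟨hq, -, h2⟩, him⟩
    exact ⟨hq, Complex.arg_nonneg_iff.2 him, h2⟩
  · rintro ⟨hq, h0, h1⟩
    refine ⟨⟨hq, by linarith [Real.pi_pos, div_nonneg Real.pi_pos.le (Nat.cast_nonneg g)], h1⟩,
      Complex.arg_nonneg_iff.1 h0⟩

/-- Points of the wedge are not on the negative real axis (`g ≥ 2`). [folklore] -/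
theorem arg_ne_pi_of_mem_wedge (hg : 2 ≤ g) {p : 𝔼 2} (hp : p ∈ wedge g) : Complex.arg (toC p) ≠ π := by
  intro h
  have hg' : (2 : ℝ) ≤ g := by exact_mod_cast hg
  have h2 := hp.2
  rw [h, abs_of_pos Real.pi_pos] at h2
  have : π / g ≤ π / 2 := div_le_div_of_nonneg_left Real.pi_pos.le two_pos hg'
  linarith [Real.pi_pos]

/-- The reflection maps the wedge to itself. [folklore] -/
theorem refl_mem_wedge (hg : 2 ≤ g) {p : 𝔼 2} (hp : p ∈ wedge g) : refl p ∈ wedge g := by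
  refine ⟨by rw [flower_refl]; exact hp.1, ?_⟩
  rw [toC_refl, Complex.arg_conj, if_neg (arg_ne_pi_of_mem_wedge hg hp), abs_neg]
  exact hp.2

/-- The lower half of the wedge is the reflected half-wedge. [folklore] -/
theorem wedge_inter_im_nonpos (hg : 2 ≤ g) : wedge g ∩ {p | (toC p).im ≤ 0} = refl '' halfWedge g := by
  ext p
  constructor
  · rintro ⟨hp, him⟩
    refine ⟨refl p, ?_, refl_refl p⟩
    rw [← wedge_inter_im_nonneg]
    have him' : (toC p).im ≤ 0 := him
    exact ⟨refl_mem_wedge hg hp, by rw [mem_setOf_eq, im_toC_refl]; linarith⟩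
  · rintro ⟨u, hu, rfl⟩
    rw [← wedge_inter_im_nonneg] at hu
    have hu2 : 0 ≤ (toC u).im := hu.2
    exact ⟨refl_mem_wedge hg hu.1, by rw [mem_setOf_eq, im_toC_refl]; linarith⟩

/-- The wedge is the union of the half-wedge and its reflection. [folklore] -/
theorem wedge_eq_union (hg : 2 ≤ g) : wedge g = halfWedge g ∪ refl '' halfWedge g := by
  rw [← wedge_inter_im_nonpos hg, ← wedge_inter_im_nonneg, ← inter_union_distrib_left]
  refine (inter_eq_left.2 fun p _ => ?_).symm
  exact le_total 0 (toC p).im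

/-- The half-wedge lies in the wedge. [folklore] -/
theorem halfWedge_subset_wedge (hg : 2 ≤ g) : halfWedge g ⊆ wedge g := by
  rw [wedge_eq_union hg]; exact subset_union_left

/-- The wedge is compact. [folklore] -/
theorem isCompact_wedge (hg : 2 ≤ g) : IsCompact (wedge g) := by
  rw [wedge_eq_union hg]
  exact (isCompact_halfWedge hg).union ((isCompact_halfWedge hg).image refl.continuous)

/-- Non-zero points of the wedge lie in the slit plane (where `arg` is continuous). [folklore] -/
theorem toC_mem_slitPlane (hg : 2 ≤ g) {p : 𝔼 2} (hp : p ∈ wedge g) (hp0 : p ≠ 0) :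
    toC p ∈ Complex.slitPlane :=
  Complex.mem_slitPlane_iff_arg.2 ⟨arg_ne_pi_of_mem_wedge hg hp, fun h => hp0 (by
    rw [← norm_eq_zero, ← norm_toC, h, norm_zero])⟩

/-! ### §2 The floor squeeze on the half-wedge -/

variable (g) in
/-- **The floor squeeze**: at time `t`, the point with polar coordinates `(r, θ)` of the half-wedge
is moved along its circle to the angle `θ_lo(r) + (1 - t)(θ - θ_lo(r))`. [folklore] -/
def sqz (t : ℝ) (p : 𝔼 2) : 𝔼 2 :=
  pol ‖p‖ (thlo g ‖p‖ + (1 - t) * (Complex.arg (toC p) - thlo g ‖p‖))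

/-- The floor squeeze in polar coordinates (`r > 0`, `θ ∈ (-π, π]`). [folklore] -/
theorem sqz_pol (t : ℝ) {r θ : ℝ} (hr : 0 < r) (hθ : θ ∈ Ioc (-π) π) :
    sqz g t (pol r θ) = pol r (thlo g r + (1 - t) * (θ - thlo g r)) := by
  rw [sqz, norm_pol, abs_of_pos hr, arg_toC_pol hr hθ]

/-- The floor squeeze fixes the origin. [folklore] -/
@[simp] theorem sqz_zero (t : ℝ) : sqz g t 0 = 0 := by simp [sqz]

/-- `‖sqz t p‖ = ‖p‖`. [folklore] -/
@[simp] theorem norm_sqz (t : ℝ) (p : 𝔼 2) : ‖sqz g t p‖ = ‖p‖ := by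
  rw [sqz, norm_pol, abs_norm]

variable (g) in
/-- **The floor set** of the half-wedge: the floor points `pol r (θ_lo r)`, `0 ≤ r ≤ ρ₄`. [folklore] -/
def floorSet (hg : 2 ≤ g) : Set (𝔼 2) := (fun r => pol r (thlo g r)) '' Icc 0 (rho4 hg)

/-- A point of the half-wedge has polar coordinates in the parameter region. [folklore] -/
theorem exists_param_of_mem_halfWedge (hg : 2 ≤ g) {p : 𝔼 2} (hp : p ∈ halfWedge g) :
    ∃ r θ, (0 ≤ r ∧ r ≤ rho4 hg ∧ thlo g r ≤ θ ∧ θ ≤ π / g) ∧ p = pol r θ := by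
  rw [halfWedge_eq_image hg] at hp
  obtain ⟨⟨r, θ⟩, h, rfl⟩ := hp
  exact ⟨r, θ, h, rfl⟩

/-- Angles in `[0, π/g]` lie in `(-π, π]` (`g ≥ 1`). [folklore] -/
theorem mem_Ioc_of_mem (hg : 1 ≤ g) {θ : ℝ} (h0 : 0 ≤ θ) (h1 : θ ≤ π / g) : θ ∈ Ioc (-π) π :=
  ⟨by linarith [Real.pi_pos], le_trans h1 (div_le_self Real.pi_pos.le (by exact_mod_cast hg))⟩

/-- The squeezed angle stays between the floor and the original angle. [folklore] -/
theorem sqz_angle_mem {t θ a : ℝ} (ht : t ∈ Icc (0 : ℝ) 1) (ha : a ≤ θ) :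
    a + (1 - t) * (θ - a) ∈ Icc a θ := by
  constructor <;> nlinarith [ht.1, ht.2]

/-- **The floor squeeze maps the half-wedge into itself** (`t ∈ [0, 1]`). [folklore] -/
theorem sqz_mem_halfWedge (hg : 2 ≤ g) {t : ℝ} (ht : t ∈ Icc (0 : ℝ) 1) {p : 𝔼 2} (hp : p ∈ halfWedge g) :
    sqz g t p ∈ halfWedge g := by
  obtain ⟨r, θ, ⟨hr0, hr, hlo, hhi⟩, rfl⟩ := exists_param_of_mem_halfWedge hg hp
  rcases hr0.eq_or_lt with h | h
  · rw [← h, pol_zero_left, sqz_zero, halfWedge_eq_image hg]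
    exact ⟨(0, 0), ⟨le_rfl, (rho4_pos hg).le, by simp, by positivity⟩, by simp⟩
  · rw [sqz_pol t h (mem_Ioc_of_mem (by omega) (le_trans (thlo_nonneg r) hlo) hhi), halfWedge_eq_image hg]
    have hmem := sqz_angle_mem ht hlo
    exact ⟨(r, thlo g r + (1 - t) * (θ - thlo g r)), ⟨hr0, hr, hmem.1, le_trans hmem.2 hhi⟩, rfl⟩

/-- At time `0` the floor squeeze is the identity on the half-wedge. [folklore] -/
theorem sqz_zero_left (hg : 2 ≤ g) {p : 𝔼 2} (hp : p ∈ halfWedge g) : sqz g 0 p = p := by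
  obtain ⟨r, θ, ⟨hr0, -, hlo, hhi⟩, rfl⟩ := exists_param_of_mem_halfWedge hg hp
  rcases hr0.eq_or_lt with h | h
  · rw [← h, pol_zero_left, sqz_zero]
  · rw [sqz_pol 0 h (mem_Ioc_of_mem (by omega) (le_trans (thlo_nonneg r) hlo) hhi)]
    congr 1; ring

/-- At time `1` the floor squeeze lands on the floor set. [folklore] -/
theorem sqz_one_mem_floorSet (hg : 2 ≤ g) {p : 𝔼 2} (hp : p ∈ halfWedge g) : sqz g 1 p ∈ floorSet g hg := by
  obtain ⟨r, θ, ⟨hr0, hr, hlo, hhi⟩, rfl⟩ := exists_param_of_mem_halfWedge hg hp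
  rcases hr0.eq_or_lt with h | h
  · rw [← h, pol_zero_left, sqz_zero]
    exact ⟨0, ⟨le_rfl, (rho4_pos hg).le⟩, by simp only; rw [pol_zero_left]⟩
  · rw [sqz_pol 1 h (mem_Ioc_of_mem (by omega) (le_trans (thlo_nonneg r) hlo) hhi)]
    exact ⟨r, ⟨hr0, hr⟩, by simp only; rw [show thlo g r + (1 - 1) * (θ - thlo g r) = thlo g r by ring]⟩

/-- The floor set lies in the half-wedge. [folklore] -/
theorem floorSet_subset_halfWedge (hg : 2 ≤ g) : floorSet g hg ⊆ halfWedge g := by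
  rintro _ ⟨r, ⟨hr0, hr⟩, rfl⟩
  rw [halfWedge_eq_image hg]
  exact ⟨(r, thlo g r), ⟨hr0, hr, le_rfl, thlo_le (by omega) r⟩, rfl⟩

/-- **The floor squeeze fixes the floor set pointwise.** [folklore] -/
theorem sqz_eq_self_of_mem_floorSet (hg : 2 ≤ g) (t : ℝ) {p : 𝔼 2} (hp : p ∈ floorSet g hg) :
    sqz g t p = p := by
  obtain ⟨r, ⟨hr0, -⟩, rfl⟩ := hp
  simp only
  rcases hr0.eq_or_lt with h | h
  · rw [← h, pol_zero_left, sqz_zero]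
  · rw [sqz_pol t h (mem_Ioc_of_mem (by omega) (thlo_nonneg r) (thlo_le (by omega) r))]
    congr 1; ring

/-- **Seam points of the half-wedge lie on the floor set** (the seam criterion). [folklore] -/
theorem mem_floorSet_of_seam (hg : 2 ≤ g) {p : 𝔼 2} (hp : p ∈ halfWedge g) (hq : flower g p = level g) :
    p ∈ floorSet g hg := by
  obtain ⟨r, θ, ⟨hr0, hr, hlo, hhi⟩, rfl⟩ := exists_param_of_mem_halfWedge hg hp
  rcases hr0.eq_or_lt with h | h
  · rw [← h, pol_zero_left, flower_zero (by omega)] at hq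
    exact absurd hq (level_pos (by omega)).ne
  · obtain ⟨-, hθ⟩ := (flower_pol_eq_level_iff hg h hr (le_trans (thlo_nonneg r) hlo) hhi).1 hq
    exact ⟨r, ⟨hr0, hr⟩, by simp only at hθ ⊢; rw [hθ]⟩

/-- **The floor squeeze fixes the seam points of the half-wedge.** [folklore] -/
theorem sqz_eq_self_of_seam (hg : 2 ≤ g) (t : ℝ) {p : 𝔼 2} (hp : p ∈ halfWedge g)
    (hq : flower g p = level g) : sqz g t p = p :=
  sqz_eq_self_of_mem_floorSet hg t (mem_floorSet_of_seam hg hp hq)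

/-- **The floor squeeze is continuous on `[0, 1] × (half-wedge)`** (indeed on `ℝ × half-wedge`).
[folklore] -/
theorem continuousOn_sqz (hg : 2 ≤ g) :
    ContinuousOn (fun x : ℝ × 𝔼 2 => sqz g x.1 x.2) ((univ : Set ℝ) ×ˢ halfWedge g) := by
  rintro ⟨t, p⟩ ⟨-, hp⟩
  by_cases hp0 : p = 0
  · -- at the origin: `‖sqz t p‖ = ‖p‖ → 0`
    subst hp0
    rw [ContinuousWithinAt, sqz_zero]
    refine squeeze_zero_norm (fun x => le_of_eq (norm_sqz (g := g) x.1 x.2)) ?_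
    have : Tendsto (fun x : ℝ × 𝔼 2 => ‖x.2‖) (𝓝 ((t, (0 : 𝔼 2)))) (𝓝 0) :=
      (continuous_norm.comp continuous_snd).tendsto' (t, (0 : 𝔼 2)) 0 (by simp)
    exact this.mono_left nhdsWithin_le_nhds
  · -- away from the origin every ingredient is continuous
    have hthlo : Continuous fun q : 𝔼 2 => thlo g ‖q‖ :=
      (continuousOn_thlo hg).comp_continuous continuous_norm fun q => norm_nonneg q
    have harg : ContinuousAt (fun q : 𝔼 2 => Complex.arg (toC q)) p :=
      (Complex.continuousAt_arg (toC_mem_slitPlane hg (halfWedge_subset_wedge hg hp) hp0)).comp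
        toC.continuous.continuousAt
    have hθ : ContinuousAt (fun x : ℝ × 𝔼 2 =>
        thlo g ‖x.2‖ + (1 - x.1) * (Complex.arg (toC x.2) - thlo g ‖x.2‖)) (t, p) := by
      have h1 : ContinuousAt (fun x : ℝ × 𝔼 2 => thlo g ‖x.2‖) (t, p) :=
        (hthlo.comp continuous_snd).continuousAt
      have h2 : ContinuousAt (fun x : ℝ × 𝔼 2 => Complex.arg (toC x.2)) (t, p) :=
        harg.comp_of_eq continuous_snd.continuousAt rfl
      have h3 : ContinuousAt (fun x : ℝ × 𝔼 2 => 1 - x.1) (t, p) := by fun_prop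
      exact h1.add (h3.mul (h2.sub h1))
    have hr : ContinuousAt (fun x : ℝ × 𝔼 2 => ‖x.2‖) (t, p) := by fun_prop
    have hcomp := (continuous_pol.continuousAt).comp (hr.prodMk hθ)
    exact hcomp.continuousWithinAt


/-! ### §3 The floor squeeze on the whole wedge (by reflection) -/

variable (g) in
/-- **The floor squeeze on the wedge**: the squeeze on the upper half, its conjugate by the
reflection on the lower half. [folklore] -/
def sqzW (t : ℝ) (p : 𝔼 2) : 𝔼 2 :=
  if 0 ≤ (toC p).im then sqz g t p else refl (sqz g t (refl p))

variable (g) in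
/-- **The floor set of the wedge**: both floors. [folklore] -/
def floorSetW (hg : 2 ≤ g) : Set (𝔼 2) := floorSet g hg ∪ refl '' floorSet g hg

/-- Membership in the upper half in terms of the imaginary part. [folklore] -/
theorem mem_halfWedge_of_mem_wedge {p : 𝔼 2} (hp : p ∈ wedge g) (him : 0 ≤ (toC p).im) :
    p ∈ halfWedge g := by
  rw [← wedge_inter_im_nonneg]; exact ⟨hp, him⟩

/-- Membership of the reflection in the upper half. [folklore] -/
theorem refl_mem_halfWedge_of_mem_wedge (hg : 2 ≤ g) {p : 𝔼 2} (hp : p ∈ wedge g) (him : (toC p).im ≤ 0) :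
    refl p ∈ halfWedge g := by
  rw [← wedge_inter_im_nonneg]
  exact ⟨refl_mem_wedge hg hp, by rw [mem_setOf_eq, im_toC_refl]; linarith⟩

/-- Points of the half-wedge have non-negative imaginary part. [folklore] -/
theorem im_nonneg_of_mem_halfWedge {p : 𝔼 2} (hp : p ∈ halfWedge g) : 0 ≤ (toC p).im :=
  Complex.arg_nonneg_iff.1 hp.2.1

/-- **Axis points of the wedge are fixed by the floor squeeze**: a point of the half-wedge with
vanishing imaginary part is `(r, 0)` with `θ_lo(r) = 0`. [folklore] -/
theorem sqz_eq_self_of_im_eq_zero (hg : 2 ≤ g) (t : ℝ) {p : 𝔼 2} (hp : p ∈ halfWedge g)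
    (him : (toC p).im = 0) : sqz g t p = p := by
  have hg1 : 1 ≤ g := le_trans one_le_two hg
  have harg : Complex.arg (toC p) = 0 := by
    have hre : 0 ≤ (toC p).re := by
      by_contra hre
      push Not at hre
      exact arg_ne_pi_of_mem_wedge hg (halfWedge_subset_wedge hg hp) (Complex.arg_eq_pi_iff.2 ⟨hre, him⟩)
    exact Complex.arg_eq_zero_iff.2 ⟨hre, him⟩
  obtain ⟨r, θ, ⟨hr0, hr, hlo, hhi⟩, hp'⟩ := exists_param_of_mem_halfWedge hg hp
  rcases hr0.eq_or_lt with h | h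
  · rw [hp', ← h, pol_zero_left, sqz_zero]
  · have hθ : θ = 0 := by
      rw [hp', arg_toC_pol h (mem_Ioc_of_mem hg1 (le_trans (thlo_nonneg r) hlo) hhi)] at harg
      exact harg
    subst hθ
    have hthlo : thlo g r = 0 := le_antisymm hlo (thlo_nonneg r)
    rw [hp', sqz_pol t h (mem_Ioc_of_mem hg1 le_rfl (by positivity)), hthlo]
    congr 1; ring

/-- On the upper half the wedge squeeze is the squeeze. [folklore] -/
theorem sqzW_of_im_nonneg (t : ℝ) {p : 𝔼 2} (him : 0 ≤ (toC p).im) : sqzW g t p = sqz g t p := by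
  rw [sqzW, if_pos him]

/-- On the lower half the wedge squeeze is the conjugated squeeze (`g ≥ 2`, `p` in the wedge).
[folklore] -/
theorem sqzW_of_im_nonpos (hg : 2 ≤ g) (t : ℝ) {p : 𝔼 2} (hp : p ∈ wedge g) (him : (toC p).im ≤ 0) :
    sqzW g t p = refl (sqz g t (refl p)) := by
  rw [sqzW]
  split_ifs with h
  · -- on the axis both formulas agree
    have him0 : (toC p).im = 0 := le_antisymm him h
    have hp' : p ∈ halfWedge g := mem_halfWedge_of_mem_wedge hp h
    rw [sqz_eq_self_of_im_eq_zero hg t hp' him0,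
      sqz_eq_self_of_im_eq_zero hg t (refl_mem_halfWedge_of_mem_wedge hg hp him)
        (by rw [im_toC_refl, him0, neg_zero]), refl_refl]
  · rfl

/-- The wedge squeeze commutes with the reflection (on the wedge). [folklore] -/
theorem sqzW_refl (hg : 2 ≤ g) (t : ℝ) {p : 𝔼 2} (hp : p ∈ wedge g) :
    sqzW g t (refl p) = refl (sqzW g t p) := by
  rcases le_total 0 (toC p).im with him | him
  · rw [sqzW_of_im_nonneg t him, sqzW_of_im_nonpos hg t (refl_mem_wedge hg hp)
      (by rw [im_toC_refl]; linarith), refl_refl]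
  · rw [sqzW_of_im_nonpos hg t hp him, sqzW_of_im_nonneg t (by rw [im_toC_refl]; linarith), refl_refl]

/-- **The wedge squeeze maps the wedge into itself** (`t ∈ [0, 1]`). [folklore] -/
theorem sqzW_mem_wedge (hg : 2 ≤ g) {t : ℝ} (ht : t ∈ Icc (0 : ℝ) 1) {p : 𝔼 2} (hp : p ∈ wedge g) :
    sqzW g t p ∈ wedge g := by
  rcases le_total 0 (toC p).im with him | him
  · rw [sqzW_of_im_nonneg t him]
    exact halfWedge_subset_wedge hg (sqz_mem_halfWedge hg ht (mem_halfWedge_of_mem_wedge hp him))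
  · rw [sqzW_of_im_nonpos hg t hp him]
    exact refl_mem_wedge hg (halfWedge_subset_wedge hg
      (sqz_mem_halfWedge hg ht (refl_mem_halfWedge_of_mem_wedge hg hp him)))

/-- At time `0` the wedge squeeze is the identity on the wedge. [folklore] -/
theorem sqzW_zero_left (hg : 2 ≤ g) {p : 𝔼 2} (hp : p ∈ wedge g) : sqzW g 0 p = p := by
  rcases le_total 0 (toC p).im with him | him
  · rw [sqzW_of_im_nonneg 0 him, sqz_zero_left hg (mem_halfWedge_of_mem_wedge hp him)]
  · rw [sqzW_of_im_nonpos hg 0 hp him, sqz_zero_left hg (refl_mem_halfWedge_of_mem_wedge hg hp him),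
      refl_refl]

/-- At time `1` the wedge squeeze lands on the floor set of the wedge. [folklore] -/
theorem sqzW_one_mem (hg : 2 ≤ g) {p : 𝔼 2} (hp : p ∈ wedge g) : sqzW g 1 p ∈ floorSetW g hg := by
  rcases le_total 0 (toC p).im with him | him
  · rw [sqzW_of_im_nonneg 1 him]
    exact Or.inl (sqz_one_mem_floorSet hg (mem_halfWedge_of_mem_wedge hp him))
  · rw [sqzW_of_im_nonpos hg 1 hp him]
    exact Or.inr ⟨_, sqz_one_mem_floorSet hg (refl_mem_halfWedge_of_mem_wedge hg hp him), rfl⟩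

/-- The floor set of the wedge lies in the wedge. [folklore] -/
theorem floorSetW_subset_wedge (hg : 2 ≤ g) : floorSetW g hg ⊆ wedge g := by
  rintro p (hp | ⟨u, hu, rfl⟩)
  · exact halfWedge_subset_wedge hg (floorSet_subset_halfWedge hg hp)
  · exact refl_mem_wedge hg (halfWedge_subset_wedge hg (floorSet_subset_halfWedge hg hu))

/-- **The wedge squeeze fixes the floor set of the wedge pointwise.** [folklore] -/
theorem sqzW_eq_self_of_mem_floorSetW (hg : 2 ≤ g) (t : ℝ) {p : 𝔼 2} (hp : p ∈ floorSetW g hg) :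
    sqzW g t p = p := by
  rcases hp with hp | ⟨u, hu, rfl⟩
  · rw [sqzW_of_im_nonneg t (im_nonneg_of_mem_halfWedge (floorSet_subset_halfWedge hg hp)),
      sqz_eq_self_of_mem_floorSet hg t hp]
  · have hu' := floorSet_subset_halfWedge hg hu
    rw [sqzW_of_im_nonpos hg t (refl_mem_wedge hg (halfWedge_subset_wedge hg hu'))
      (by rw [im_toC_refl]; linarith [im_nonneg_of_mem_halfWedge hu']), refl_refl,
      sqz_eq_self_of_mem_floorSet hg t hu]

/-- **Seam points of the wedge lie on its floor set.** [folklore] -/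
theorem mem_floorSetW_of_seam (hg : 2 ≤ g) {p : 𝔼 2} (hp : p ∈ wedge g) (hq : flower g p = level g) :
    p ∈ floorSetW g hg := by
  rcases le_total 0 (toC p).im with him | him
  · exact Or.inl (mem_floorSet_of_seam hg (mem_halfWedge_of_mem_wedge hp him) hq)
  · refine Or.inr ⟨refl p, mem_floorSet_of_seam hg (refl_mem_halfWedge_of_mem_wedge hg hp him) ?_,
      refl_refl p⟩
    rw [flower_refl]; exact hq

/-- **The wedge squeeze fixes the seam points of the wedge.** [folklore] -/
theorem sqzW_eq_self_of_seam (hg : 2 ≤ g) (t : ℝ) {p : 𝔼 2} (hp : p ∈ wedge g) (hq : flower g p = level g) :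
    sqzW g t p = p :=
  sqzW_eq_self_of_mem_floorSetW hg t (mem_floorSetW_of_seam hg hp hq)

/-- The half-wedge is closed. [folklore] -/
theorem isClosed_halfWedge (hg : 2 ≤ g) : IsClosed (halfWedge g) := (isCompact_halfWedge hg).isClosed

/-- **The wedge squeeze is continuous on `ℝ × wedge`** (pasting the two closed halves). [folklore] -/
theorem continuousOn_sqzW (hg : 2 ≤ g) :
    ContinuousOn (fun x : ℝ × 𝔼 2 => sqzW g x.1 x.2) ((univ : Set ℝ) ×ˢ wedge g) := by
  have hup := continuousOn_sqz (g := g) hg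
  -- the conjugated squeeze is continuous on `ℝ × (lower half)`
  have hmaps : MapsTo (fun x : ℝ × 𝔼 2 => (x.1, refl x.2)) ((univ : Set ℝ) ×ˢ (refl '' halfWedge g))
      ((univ : Set ℝ) ×ˢ halfWedge g) := by
    rintro ⟨t, p⟩ ⟨-, ⟨u, hu, rfl⟩⟩
    refine ⟨mem_univ _, ?_⟩
    show refl (refl u) ∈ halfWedge g
    rw [refl_refl]; exact hu
  have hinner : Continuous fun x : ℝ × 𝔼 2 => (x.1, refl x.2) :=
    continuous_fst.prodMk (refl.continuous.comp continuous_snd)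
  have hlow : ContinuousOn (fun x : ℝ × 𝔼 2 => refl (sqz g x.1 (refl x.2)))
      ((univ : Set ℝ) ×ˢ (refl '' halfWedge g)) := by
    show ContinuousOn (⇑refl ∘ ((fun x : ℝ × 𝔼 2 => sqz g x.1 x.2) ∘ fun x : ℝ × 𝔼 2 => (x.1, refl x.2)))
      ((univ : Set ℝ) ×ˢ (refl '' halfWedge g))
    exact refl.continuous.comp_continuousOn (hup.comp hinner.continuousOn hmaps)
  rw [wedge_eq_union hg, prod_union]
  refine ContinuousOn.union_of_isClosed (hup.congr ?_) (hlow.congr ?_)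
    (isClosed_univ.prod (isClosed_halfWedge hg))
    (isClosed_univ.prod ((isCompact_halfWedge hg).image refl.continuous).isClosed)
  · rintro ⟨t, p⟩ ⟨-, hp⟩
    exact sqzW_of_im_nonneg t (im_nonneg_of_mem_halfWedge hp)
  · rintro ⟨t, p⟩ ⟨-, ⟨u, hu, rfl⟩⟩
    exact sqzW_of_im_nonpos hg t (refl_mem_wedge hg (halfWedge_subset_wedge hg hu))
      (by rw [im_toC_refl]; linarith [im_nonneg_of_mem_halfWedge hu])

/-! ### §4 The axis slide on the floor set -/

/-- **The axis slide**: the points of the floor set at distance `≤ ρ₁` from the origin (the axis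
segment `[0, ρ₁]`) slide along the axis into the inner pinch point `(ρ₁, 0)`. [folklore] -/
def slide (hg : 2 ≤ g) (t : ℝ) (p : 𝔼 2) : 𝔼 2 :=
  if ‖p‖ ≤ rho1 hg then ax (‖p‖ + t * (rho1 hg - ‖p‖)) else p

variable (g) in
/-- **The spine floor**: the floor points beyond the inner pinch radius, `pol r (θ_lo r)` for
`ρ₁ ≤ r ≤ ρ₄`, and their reflections: the lens curve, the segment `m` of the peak ray and the outer
boundary arc of the wedge. [folklore] -/
def spineFloor (hg : 2 ≤ g) : Set (𝔼 2) :=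
  (fun r => pol r (thlo g r)) '' Icc (rho1 hg) (rho4 hg) ∪ refl '' ((fun r => pol r (thlo g r)) '' Icc (rho1 hg) (rho4 hg))

/-- `ρ₁ < ρ₄`. [folklore] -/
theorem rho1_lt_rho4 (hg : 2 ≤ g) : rho1 hg < rho4 hg :=
  lt_trans (rho1_lt_rt_seven hg) (rt_seven_lt_rho4 hg)

/-- A floor point of norm `≤ ρ₁` is the axis point `(r, 0)`. [folklore] -/
theorem pol_thlo_eq_ax (hg : 2 ≤ g) {r : ℝ} (hr0 : 0 ≤ r) (hr : r ≤ rho1 hg) : pol r (thlo g r) = ax r := by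
  rw [thlo_eq_zero_of_le_rho1 hg hr0 hr, pol_zero_right]

/-- Description of the floor set of the wedge: points `pol r (±θ_lo r)`. [folklore] -/
theorem mem_floorSetW_iff (hg : 2 ≤ g) {p : 𝔼 2} :
    p ∈ floorSetW g hg ↔ ∃ r ∈ Icc 0 (rho4 hg), p = pol r (thlo g r) ∨ p = pol r (-thlo g r) := by
  constructor
  · rintro (⟨r, hr, rfl⟩ | ⟨_, ⟨r, hr, rfl⟩, rfl⟩)
    · exact ⟨r, hr, Or.inl rfl⟩
    · exact ⟨r, hr, Or.inr (refl_pol r _)⟩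
  · rintro ⟨r, hr, h | h⟩
    · exact Or.inl ⟨r, hr, h.symm⟩
    · exact Or.inr ⟨pol r (thlo g r), ⟨r, hr, rfl⟩, by rw [refl_pol, h]⟩

/-- The spine floor lies in the floor set of the wedge. [folklore] -/
theorem spineFloor_subset (hg : 2 ≤ g) : spineFloor g hg ⊆ floorSetW g hg := by
  rintro p (⟨r, hr, rfl⟩ | ⟨_, ⟨r, hr, rfl⟩, rfl⟩)
  · exact Or.inl ⟨r, ⟨le_trans (rho1_pos hg).le hr.1, hr.2⟩, rfl⟩
  · exact Or.inr ⟨_, ⟨r, ⟨le_trans (rho1_pos hg).le hr.1, hr.2⟩, rfl⟩, rfl⟩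

/-- The norm of a floor point. [folklore] -/
theorem norm_pol_of_nonneg {r : ℝ} (hr : 0 ≤ r) (θ : ℝ) : ‖pol r θ‖ = r := by rw [norm_pol, abs_of_nonneg hr]

/-- A floor point of the wedge of norm `≤ ρ₁` is an axis point. [folklore] -/
theorem eq_ax_of_mem_floorSetW (hg : 2 ≤ g) {p : 𝔼 2} (hp : p ∈ floorSetW g hg) (hn : ‖p‖ ≤ rho1 hg) :
    p = ax ‖p‖ := by
  obtain ⟨r, ⟨hr0, hr⟩, h⟩ := (mem_floorSetW_iff hg).1 hp
  have hnr : ‖p‖ = r := by rcases h with rfl | rfl <;> exact norm_pol_of_nonneg hr0 _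
  rw [hnr] at hn ⊢
  have h0 : thlo g r = 0 := thlo_eq_zero_of_le_rho1 hg hr0 hn
  rcases h with rfl | rfl
  · rw [h0, pol_zero_right]
  · rw [h0, neg_zero, pol_zero_right]

/-- A floor point of the wedge of norm `≥ ρ₁` lies on the spine floor. [folklore] -/
theorem mem_spineFloor_of_le_norm (hg : 2 ≤ g) {p : 𝔼 2} (hp : p ∈ floorSetW g hg) (hn : rho1 hg ≤ ‖p‖) :
    p ∈ spineFloor g hg := by
  obtain ⟨r, ⟨hr0, hr⟩, h⟩ := (mem_floorSetW_iff hg).1 hp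
  have hnr : ‖p‖ = r := by rcases h with rfl | rfl <;> exact norm_pol_of_nonneg hr0 _
  rw [hnr] at hn
  rcases h with rfl | rfl
  · exact Or.inl ⟨r, ⟨hn, hr⟩, rfl⟩
  · exact Or.inr ⟨pol r (thlo g r), ⟨r, ⟨hn, hr⟩, rfl⟩, refl_pol r _⟩

/-- Axis points `(r, 0)` with `0 ≤ r ≤ ρ₁` lie on the floor set of the wedge. [folklore] -/
theorem ax_mem_floorSetW (hg : 2 ≤ g) {r : ℝ} (hr0 : 0 ≤ r) (hr : r ≤ rho1 hg) : ax r ∈ floorSetW g hg :=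
  Or.inl ⟨r, ⟨hr0, le_trans hr (rho1_lt_rho4 hg).le⟩, pol_thlo_eq_ax hg hr0 hr⟩

/-- **The axis slide maps the floor set into itself** (`t ∈ [0, 1]`). [folklore] -/
theorem slide_mem (hg : 2 ≤ g) {t : ℝ} (ht : t ∈ Icc (0 : ℝ) 1) {p : 𝔼 2} (hp : p ∈ floorSetW g hg) :
    slide hg t p ∈ floorSetW g hg := by
  rw [slide]
  split_ifs with h
  · have h1 : 0 ≤ ‖p‖ + t * (rho1 hg - ‖p‖) := by nlinarith [norm_nonneg p, ht.1]
    have h2 : ‖p‖ + t * (rho1 hg - ‖p‖) ≤ rho1 hg := by nlinarith [ht.2]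
    exact ax_mem_floorSetW hg h1 h2
  · exact hp

/-- At time `0` the axis slide is the identity on the floor set. [folklore] -/
theorem slide_zero (hg : 2 ≤ g) {p : 𝔼 2} (hp : p ∈ floorSetW g hg) : slide hg 0 p = p := by
  rw [slide]
  split_ifs with h
  · rw [zero_mul, add_zero]; exact (eq_ax_of_mem_floorSetW hg hp h).symm
  · rfl

/-- At time `1` the axis slide lands on the spine floor. [folklore] -/
theorem slide_one_mem (hg : 2 ≤ g) {p : 𝔼 2} (hp : p ∈ floorSetW g hg) : slide hg 1 p ∈ spineFloor g hg := by
  rw [slide]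
  split_ifs with h
  · rw [one_mul, add_sub_cancel]
    exact Or.inl ⟨rho1 hg, ⟨le_rfl, (rho1_lt_rho4 hg).le⟩, pol_thlo_eq_ax hg (rho1_pos hg).le le_rfl⟩
  · exact mem_spineFloor_of_le_norm hg hp (le_of_lt (lt_of_not_ge h))

/-- The norm of a point of the spine floor is at least `ρ₁`. [folklore] -/
theorem rho1_le_norm_of_mem_spineFloor (hg : 2 ≤ g) {p : 𝔼 2} (hp : p ∈ spineFloor g hg) : rho1 hg ≤ ‖p‖ := by
  rcases hp with ⟨r, hr, rfl⟩ | ⟨_, ⟨r, hr, rfl⟩, rfl⟩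
  · rw [norm_pol_of_nonneg (le_trans (rho1_pos hg).le hr.1)]; exact hr.1
  · rw [norm_refl, norm_pol_of_nonneg (le_trans (rho1_pos hg).le hr.1)]; exact hr.1

/-- **The axis slide fixes the spine floor pointwise.** [folklore] -/
theorem slide_eq_self_of_mem_spineFloor (hg : 2 ≤ g) (t : ℝ) {p : 𝔼 2} (hp : p ∈ spineFloor g hg) :
    slide hg t p = p := by
  rw [slide]
  split_ifs with h
  · have heq : ‖p‖ = rho1 hg := le_antisymm h (rho1_le_norm_of_mem_spineFloor hg hp)
    rw [heq, sub_self, mul_zero, add_zero, ← heq]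
    exact (eq_ax_of_mem_floorSetW hg (spineFloor_subset hg hp) h).symm
  · rfl

/-- Seam points of the floor set lie on the spine floor (they have norm `≥ ρ₁`). [folklore] -/
theorem mem_spineFloor_of_seam (hg : 2 ≤ g) {p : 𝔼 2} (hp : p ∈ floorSetW g hg) (hq : flower g p = level g) :
    p ∈ spineFloor g hg := by
  refine mem_spineFloor_of_le_norm hg hp ?_
  by_contra hlt
  push Not at hlt
  have hp' := eq_ax_of_mem_floorSetW hg hp hlt.le
  rw [hp', ← pol_zero_right] at hq
  have : prof g ‖p‖ ≤ level g := by
    rcases (norm_nonneg p).eq_or_lt with h0 | h0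
    · rw [← h0, prof_zero (by omega)]; exact (level_pos (by omega)).le
    · exact ((prof_le_level_iff_left hg (norm_nonneg p) (le_trans hlt.le (rho1_mem hg).2.le)).2 hlt.le)
  have hlt' : prof g ‖p‖ < level g := by
    rcases (norm_nonneg p).eq_or_lt with h0 | h0
    · rw [← h0, prof_zero (by omega)]; exact level_pos (by omega)
    · have := (strictMonoOn_prof_left hg) ⟨norm_nonneg p, le_trans hlt.le (rho1_mem hg).2.le⟩
        ⟨(rho1_pos hg).le, (rho1_mem hg).2.le⟩ hlt
      rwa [prof_rho1 hg] at this
  rw [flower_pol, mul_zero, Real.cos_zero, mul_one, ← prof_eq] at hq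
  linarith

/-- **The axis slide fixes the seam points of the floor set.** [folklore] -/
theorem slide_eq_self_of_seam (hg : 2 ≤ g) (t : ℝ) {p : 𝔼 2} (hp : p ∈ floorSetW g hg)
    (hq : flower g p = level g) : slide hg t p = p :=
  slide_eq_self_of_mem_spineFloor hg t (mem_spineFloor_of_seam hg hp hq)

/-- The floor curve `r ↦ pol r (θ_lo r)` is continuous on `[0, ∞)`. [folklore] -/
theorem continuousOn_pol_thlo (hg : 2 ≤ g) : ContinuousOn (fun r => pol r (thlo g r)) (Ici 0) := by
  have h := (continuousOn_id (s := Ici (0 : ℝ))).prodMk (continuousOn_thlo hg)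
  show ContinuousOn ((fun x : ℝ × ℝ => pol x.1 x.2) ∘ fun r => (id r, thlo g r)) (Ici 0)
  exact continuous_pol.comp_continuousOn h

/-- The floor set is compact. [folklore] -/
theorem isCompact_floorSet (hg : 2 ≤ g) : IsCompact (floorSet g hg) :=
  isCompact_Icc.image_of_continuousOn ((continuousOn_pol_thlo hg).mono fun _ hr => hr.1)

/-- The floor set of the wedge is closed. [folklore] -/
theorem isClosed_floorSetW (hg : 2 ≤ g) : IsClosed (floorSetW g hg) :=
  ((isCompact_floorSet hg).union ((isCompact_floorSet hg).image refl.continuous)).isClosed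

/-- **The axis slide is continuous on `ℝ × (floor set)`** (pasting the two closed pieces
`‖p‖ ≤ ρ₁` and `‖p‖ ≥ ρ₁`, on whose intersection the slide is the identity). [folklore] -/
theorem continuousOn_slide (hg : 2 ≤ g) :
    ContinuousOn (fun x : ℝ × 𝔼 2 => slide hg x.1 x.2) ((univ : Set ℝ) ×ˢ floorSetW g hg) := by
  have hax : Continuous fun x : ℝ × 𝔼 2 => ax (‖x.2‖ + x.1 * (rho1 hg - ‖x.2‖)) := by
    unfold ax
    refine toC.symm.continuous.comp (Complex.continuous_ofReal.comp ?_)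
    fun_prop
  have hsplit : floorSetW g hg = (floorSetW g hg ∩ {p | ‖p‖ ≤ rho1 hg}) ∪ (floorSetW g hg ∩ {p | rho1 hg ≤ ‖p‖}) := by
    rw [← inter_union_distrib_left]
    exact (inter_eq_left.2 fun p _ => le_total ‖p‖ (rho1 hg)).symm
  rw [hsplit, prod_union]
  refine ContinuousOn.union_of_isClosed (hax.continuousOn.congr ?_) (continuousOn_snd.congr ?_)
    (isClosed_univ.prod ((isClosed_floorSetW hg).inter
      (isClosed_le (continuous_norm (E := 𝔼 2)) continuous_const)))
    (isClosed_univ.prod ((isClosed_floorSetW hg).inter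
      (isClosed_le continuous_const (continuous_norm (E := 𝔼 2)))))
  · rintro ⟨t, p⟩ ⟨-, -, hp⟩
    have hp' : ‖p‖ ≤ rho1 hg := hp
    show slide hg t p = ax (‖p‖ + t * (rho1 hg - ‖p‖))
    rw [slide, if_pos hp']
  · rintro ⟨t, p⟩ ⟨-, hp, hle⟩
    have hle' : rho1 hg ≤ ‖p‖ := hle
    show slide hg t p = p
    rw [slide]
    split_ifs with h
    · have heq : ‖p‖ = rho1 hg := le_antisymm h hle'
      rw [heq, sub_self, mul_zero, add_zero, ← heq]
      exact (eq_ax_of_mem_floorSetW hg hp h).symm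
    · rfl

/-! ### §5 The sector of the flower surface deformation retracts onto the double of the spine floor -/

variable (g) in
/-- **The flower surface** `Z = {q_g(x, y) + z² = c_g}`, the double of the flower domain. [folklore] -/
def flowerSurface : Set (𝔼 3) := double (flower g) (level g)

variable (g) in
/-- **The sector** of the flower surface over the wedge: a one-holed torus. [folklore] -/
def sectorZ : Set (𝔼 3) := flowerSurface g ∩ proj ⁻¹' wedge g

variable (g) in
/-- The part of the flower surface over the floor set of the wedge. [folklore] -/
def floorZ (hg : 2 ≤ g) : Set (𝔼 3) := flowerSurface g ∩ proj ⁻¹' floorSetW g hg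

variable (g) in
/-- **The spine of the sector**: the part of the flower surface over the spine floor — the lens
curve `L`, the two copies `m⁺`, `m⁻` of the peak segment `m` and the outer boundary arc `O` of the
wedge (a graph; after collapsing the whiskers of `O`, a wedge of two circles). [folklore] -/
def spineZ (hg : 2 ≤ g) : Set (𝔼 3) := flowerSurface g ∩ proj ⁻¹' spineFloor g hg

/-- The wedge lies in the flower domain. [folklore] -/
theorem flower_le_of_mem_wedge {p : 𝔼 2} (hp : p ∈ wedge g) : flower g p ≤ level g := hp.1

/-- **Stage 1**: the sector deformation retracts onto its part over the floor set (lift of the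
wedge squeeze). [folklore] -/
theorem floorZ_isStrongDeformationRetractOf_sectorZ (hg : 2 ≤ g) :
    IsStrongDeformationRetractOf (floorZ g hg) (sectorZ g) := by
  refine isStrongDeformationRetractOf_double contDiff_flower.continuous (sqzW g) ?_ ?_ ?_ ?_ ?_ ?_ ?_
  · exact (continuousOn_sqzW hg).mono (prod_mono (subset_univ _) le_rfl)
  · exact fun t ht p hp => sqzW_mem_wedge hg ht hp
  · exact fun p hp => flower_le_of_mem_wedge hp
  · exact fun t _ p hp hq => sqzW_eq_self_of_seam hg t hp hq
  · exact fun p hp => sqzW_zero_left hg hp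
  · exact fun p hp => sqzW_one_mem hg hp
  · exact fun t _ p _ hpK => sqzW_eq_self_of_mem_floorSetW hg t hpK

/-- **Stage 2**: the part over the floor set deformation retracts onto the spine (lift of the axis
slide). [folklore] -/
theorem spineZ_isStrongDeformationRetractOf_floorZ (hg : 2 ≤ g) :
    IsStrongDeformationRetractOf (spineZ g hg) (floorZ g hg) := by
  refine isStrongDeformationRetractOf_double contDiff_flower.continuous (slide hg) ?_ ?_ ?_ ?_ ?_ ?_ ?_
  · exact (continuousOn_slide hg).mono (prod_mono (subset_univ _) le_rfl)
  · exact fun t ht p hp => slide_mem hg ht hp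
  · exact fun p hp => flower_le_of_mem_wedge (floorSetW_subset_wedge hg hp)
  · exact fun t _ p hp hq => slide_eq_self_of_seam hg t hp hq
  · exact fun p hp => slide_zero hg hp
  · exact fun p hp => slide_one_mem hg hp
  · exact fun t _ p _ hpK => slide_eq_self_of_mem_spineFloor hg t hpK

/-- **The sector of the flower surface strong deformation retracts onto its spine.** [folklore] -/
theorem spineZ_isStrongDeformationRetractOf_sectorZ (hg : 2 ≤ g) :
    IsStrongDeformationRetractOf (spineZ g hg) (sectorZ g) :=
  (floorZ_isStrongDeformationRetractOf_sectorZ hg).trans (spineZ_isStrongDeformationRetractOf_floorZ hg)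
    (inter_subset_inter_right _ (preimage_mono (floorSetW_subset_wedge hg)))
    (inter_subset_inter_right _ (preimage_mono (spineFloor_subset hg)))

/-- The sector is compact. [folklore] -/
theorem isCompact_sectorZ (hg : 2 ≤ g) : IsCompact (sectorZ g) :=
  isCompact_double_inter contDiff_flower.continuous (isCompact_wedge hg) fun _ hp => hp.1

/-- The sector is closed. [folklore] -/
theorem isClosed_sectorZ (hg : 2 ≤ g) : IsClosed (sectorZ g) := (isCompact_sectorZ hg).isClosed


/-! ### §6 Collapsing the whiskers: the outer boundary arc `O` slides into the indentation point `Q` -/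

/-- **The indentation point** `Q = (ρ₃, 0, 0)`: the midpoint of the outer boundary arc of the wedge,
where the peak segment `m` ends. [folklore] -/
def ptQ (hg : 2 ≤ g) : 𝔼 3 := lift (ax (rho3 hg))

/-- The radius after sliding: `ρ₃ + (1 - s)(‖π p‖ - ρ₃)`. [folklore] -/
def whiskerRadius (hg : 2 ≤ g) (s : ℝ) (p : 𝔼 3) : ℝ := rho3 hg + (1 - s) * (‖proj p‖ - rho3 hg)

/-- **The whisker collapse** on the spine: points over the outer arc `O` (those with
`‖π p‖ ≥ ρ₃`) slide along `O` towards `Q`; the rest of the spine stays put. [folklore] -/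
def whisker (hg : 2 ≤ g) (s : ℝ) (p : 𝔼 3) : 𝔼 3 :=
  if rho3 hg ≤ ‖proj p‖ then
    (if 0 ≤ (toC (proj p)).im then lift (pol (whiskerRadius hg s p) (thlo g (whiskerRadius hg s p)))
      else lift (pol (whiskerRadius hg s p) (-thlo g (whiskerRadius hg s p))))
  else p

variable (g) in
/-- **The reduced spine** `L ∪ m⁺ ∪ m⁻` (through the point `Q`): the part of the spine over
`{‖u‖ ≤ ρ₃}`. [folklore] -/
def spineZ' (hg : 2 ≤ g) : Set (𝔼 3) := spineZ g hg ∩ {p | ‖proj p‖ ≤ rho3 hg}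

/-- `ρ₁ ≤ ρ₃`. [folklore] -/
theorem rho1_le_rho3 (hg : 2 ≤ g) : rho1 hg ≤ rho3 hg :=
  le_of_lt (lt_trans (rho1_lt_rt_seven hg) (rt_seven_lt_rho3 hg))

/-- Floor points beyond `ρ₃` are seam points. [folklore] -/
theorem flower_pol_thlo_eq_of_rho3_le (hg : 2 ≤ g) {r : ℝ} (h3 : rho3 hg ≤ r) (h4 : r ≤ rho4 hg) :
    flower g (pol r (thlo g r)) = level g :=
  (flower_pol_thlo_eq_level_iff hg (lt_of_lt_of_le (rho3_pos hg) h3) h4).2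
    ((level_le_prof_iff hg (le_trans (rho3_pos hg).le h3)).2 (Or.inr h3))

/-- A seam point `lift u` (`q u = c`) lies on the flower surface. [folklore] -/
theorem lift_mem_flowerSurface {u : 𝔼 2} (hu : flower g u = level g) : lift u ∈ flowerSurface g := by
  rw [flowerSurface, ← upperPt_eq_lift hu]; exact upperPt_mem hu.le

/-- The seam points `lift (pol r (±θ_lo r))`, `ρ₃ ≤ r ≤ ρ₄`, lie on the spine. [folklore] -/
theorem lift_pol_thlo_mem_spineZ (hg : 2 ≤ g) {r : ℝ} (h3 : rho3 hg ≤ r) (h4 : r ≤ rho4 hg) :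
    lift (pol r (thlo g r)) ∈ spineZ g hg ∧ lift (pol r (-thlo g r)) ∈ spineZ g hg := by
  have h1 : rho1 hg ≤ r := le_trans (rho1_le_rho3 hg) h3
  have hq : flower g (pol r (thlo g r)) = level g := flower_pol_thlo_eq_of_rho3_le hg h3 h4
  have hq' : flower g (pol r (-thlo g r)) = level g := by rw [flower_pol_neg]; exact hq
  refine ⟨⟨lift_mem_flowerSurface hq, ?_⟩, ⟨lift_mem_flowerSurface hq', ?_⟩⟩
  · show proj (lift (pol r (thlo g r))) ∈ spineFloor g hg
    rw [proj_lift]; exact Or.inl ⟨r, ⟨h1, h4⟩, rfl⟩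
  · show proj (lift (pol r (-thlo g r))) ∈ spineFloor g hg
    rw [proj_lift]; exact Or.inr ⟨pol r (thlo g r), ⟨r, ⟨h1, h4⟩, rfl⟩, refl_pol r _⟩

/-- `sin θ_lo ≥ 0`. [folklore] -/
theorem sin_thlo_nonneg (hg : 1 ≤ g) (r : ℝ) : 0 ≤ Real.sin (thlo g r) :=
  Real.sin_nonneg_of_nonneg_of_le_pi (thlo_nonneg r)
    (le_trans (thlo_le hg r) (div_le_self Real.pi_pos.le (by exact_mod_cast hg)))

/-- **Points of the spine**: `π p = pol r (±θ_lo r)` with `r = ‖π p‖ ∈ [ρ₁, ρ₄]`, the sign being that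
of the imaginary part. [folklore] -/
theorem proj_eq_of_mem_spineZ (hg : 2 ≤ g) {p : 𝔼 3} (hp : p ∈ spineZ g hg) :
    ‖proj p‖ ∈ Icc (rho1 hg) (rho4 hg) ∧
      ((0 ≤ (toC (proj p)).im ∧ proj p = pol ‖proj p‖ (thlo g ‖proj p‖)) ∨
        ((toC (proj p)).im ≤ 0 ∧ proj p = pol ‖proj p‖ (-thlo g ‖proj p‖))) := by
  have hπ : proj p ∈ spineFloor g hg := hp.2
  have key : ∃ r ∈ Icc (rho1 hg) (rho4 hg), proj p = pol r (thlo g r) ∨ proj p = pol r (-thlo g r) := by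
    rcases hπ with ⟨r, hr, h⟩ | ⟨_, ⟨r, hr, rfl⟩, h⟩
    · exact ⟨r, hr, Or.inl h.symm⟩
    · exact ⟨r, hr, Or.inr (by rw [← h, refl_pol])⟩
  obtain ⟨r, hr, h⟩ := key
  have hr0 : 0 ≤ r := le_trans (rho1_pos hg).le hr.1
  have hnr : ‖proj p‖ = r := by rcases h with h | h <;> rw [h, norm_pol_of_nonneg hr0]
  rw [hnr]
  refine ⟨hr, ?_⟩
  have hs := sin_thlo_nonneg (g := g) (by omega) r
  rcases h with h | h
  · left; refine ⟨?_, h⟩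
    rw [h, im_toC_pol]; exact mul_nonneg hr0 hs
  · right; refine ⟨?_, h⟩
    rw [h, im_toC_pol, Real.sin_neg]; nlinarith

/-- Points of the spine over `{‖u‖ ≥ ρ₃}` are seam points: `p = lift (π p)`. [folklore] -/
theorem eq_lift_proj_of_mem_spineZ (hg : 2 ≤ g) {p : 𝔼 3} (hp : p ∈ spineZ g hg) (h3 : rho3 hg ≤ ‖proj p‖) :
    p = lift (proj p) := by
  obtain ⟨⟨-, h4⟩, h⟩ := proj_eq_of_mem_spineZ hg hp
  have hq : flower g (proj p) = level g := by
    rcases h with ⟨-, h⟩ | ⟨-, h⟩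
    · rw [h]; exact flower_pol_thlo_eq_of_rho3_le hg h3 h4
    · rw [h, flower_pol_neg]; exact flower_pol_thlo_eq_of_rho3_le hg h3 h4
  exact (eq_lift_proj_iff p).2 ((apply_two_eq_zero_iff hp.1).2 hq)

/-- A spine point over `{‖u‖ ≥ ρ₃}` with vanishing imaginary part is `Q`. [folklore] -/
theorem eq_ptQ_of_mem_spineZ (hg : 2 ≤ g) {p : 𝔼 3} (hp : p ∈ spineZ g hg) (h3 : rho3 hg ≤ ‖proj p‖)
    (him : (toC (proj p)).im = 0) : p = ptQ hg := by
  obtain ⟨⟨-, h4⟩, h⟩ := proj_eq_of_mem_spineZ hg hp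
  have hr0 : 0 < ‖proj p‖ := lt_of_lt_of_le (rho3_pos hg) h3
  -- the angle vanishes, so `θ_lo(r) = 0`, so `r ≤ ρ₃`
  have hthlo : thlo g ‖proj p‖ = 0 := by
    have hsin : Real.sin (thlo g ‖proj p‖) = 0 := by
      rcases h with ⟨-, h⟩ | ⟨-, h⟩
      · rw [h, im_toC_pol] at him
        exact (mul_eq_zero.1 him).resolve_left hr0.ne'
      · rw [h, im_toC_pol, Real.sin_neg, mul_neg, neg_eq_zero] at him
        exact (mul_eq_zero.1 him).resolve_left hr0.ne'
    rcases (thlo_nonneg (g := g) ‖proj p‖).eq_or_lt with h0 | h0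
    · exact h0.symm
    · exfalso
      have hlt : thlo g ‖proj p‖ < π := lt_of_le_of_lt (thlo_le (by omega) _)
        (by
          have hg' : (2 : ℝ) ≤ g := by exact_mod_cast hg
          calc π / g ≤ π / 2 := div_le_div_of_nonneg_left Real.pi_pos.le two_pos hg'
            _ < π := by linarith [Real.pi_pos])
      exact (Real.sin_pos_of_pos_of_lt_pi h0 hlt).ne' hsin
  have hr3 : ‖proj p‖ = rho3 hg := by
    refine le_antisymm ?_ h3
    by_contra hlt
    push Not at hlt
    exact (thlo_pos_of_rho3_lt hg hlt).ne' hthlo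
  rw [eq_lift_proj_of_mem_spineZ hg hp h3, ptQ]
  congr 1
  rcases h with ⟨-, h⟩ | ⟨-, h⟩
  · rw [h, hthlo, hr3, pol_zero_right]
  · rw [h, hthlo, neg_zero, hr3, pol_zero_right]

/-- `Q` lies on the reduced spine. [folklore] -/
theorem ptQ_mem_spineZ' (hg : 2 ≤ g) : ptQ hg ∈ spineZ' g hg := by
  have h := (lift_pol_thlo_mem_spineZ hg le_rfl (rho3_lt_rho4 hg).le).1
  rw [thlo_eq_zero_of_mem hg (rt_seven_lt_rho3 hg).le le_rfl, pol_zero_right] at h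
  exact ⟨h, by simp [ptQ, norm_ax, abs_of_pos (rho3_pos hg)]⟩

/-- The sliding radius stays in `[ρ₃, ‖π p‖]` (`s ∈ [0, 1]`, `‖π p‖ ≥ ρ₃`). [folklore] -/
theorem whiskerRadius_mem (hg : 2 ≤ g) {s : ℝ} (hs : s ∈ Icc (0 : ℝ) 1) {p : 𝔼 3} (h3 : rho3 hg ≤ ‖proj p‖) :
    whiskerRadius hg s p ∈ Icc (rho3 hg) ‖proj p‖ := by
  rw [whiskerRadius]; constructor <;> nlinarith [hs.1, hs.2]

/-- **The whisker collapse maps the spine into itself** (`s ∈ [0, 1]`). [folklore] -/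
theorem whisker_mem (hg : 2 ≤ g) {s : ℝ} (hs : s ∈ Icc (0 : ℝ) 1) {p : 𝔼 3} (hp : p ∈ spineZ g hg) :
    whisker hg s p ∈ spineZ g hg := by
  rw [whisker]
  split_ifs with h3 him
  · obtain ⟨⟨-, h4⟩, -⟩ := proj_eq_of_mem_spineZ hg hp
    have hm := whiskerRadius_mem hg hs h3
    exact (lift_pol_thlo_mem_spineZ hg hm.1 (le_trans hm.2 h4)).1
  · obtain ⟨⟨-, h4⟩, -⟩ := proj_eq_of_mem_spineZ hg hp
    have hm := whiskerRadius_mem hg hs h3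
    exact (lift_pol_thlo_mem_spineZ hg hm.1 (le_trans hm.2 h4)).2
  · exact hp

/-- At time `0` the whisker collapse is the identity on the spine. [folklore] -/
theorem whisker_zero (hg : 2 ≤ g) {p : 𝔼 3} (hp : p ∈ spineZ g hg) : whisker hg 0 p = p := by
  rw [whisker]
  have hw : whiskerRadius hg 0 p = ‖proj p‖ := by rw [whiskerRadius]; ring
  split_ifs with h3 him
  · rw [hw]
    obtain ⟨-, ⟨-, h⟩ | ⟨him', h⟩⟩ := proj_eq_of_mem_spineZ hg hp
    · rw [← h]; exact (eq_lift_proj_of_mem_spineZ hg hp h3).symm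
    · have him0 : (toC (proj p)).im = 0 := le_antisymm him' him
      rw [eq_ptQ_of_mem_spineZ hg hp h3 him0, ptQ]
      simp only [proj_lift, norm_ax, abs_of_pos (rho3_pos hg)]
      rw [thlo_eq_zero_of_mem hg (rt_seven_lt_rho3 hg).le le_rfl, pol_zero_right]
  · rw [hw]
    obtain ⟨-, ⟨him', h⟩ | ⟨-, h⟩⟩ := proj_eq_of_mem_spineZ hg hp
    · exact absurd him' him
    · rw [← h]; exact (eq_lift_proj_of_mem_spineZ hg hp h3).symm
  · rfl

/-- At time `1` the whisker collapse lands on the reduced spine. [folklore] -/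
theorem whisker_one_mem (hg : 2 ≤ g) {p : 𝔼 3} (hp : p ∈ spineZ g hg) : whisker hg 1 p ∈ spineZ' g hg := by
  have hmem := whisker_mem hg ⟨zero_le_one, le_rfl⟩ hp
  refine ⟨hmem, ?_⟩
  show ‖proj (whisker hg 1 p)‖ ≤ rho3 hg
  rw [whisker]
  have hw : whiskerRadius hg 1 p = rho3 hg := by rw [whiskerRadius]; ring
  split_ifs with h3 him
  · rw [proj_lift, hw, norm_pol_of_nonneg (rho3_pos hg).le]
  · rw [proj_lift, hw, norm_pol_of_nonneg (rho3_pos hg).le]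
  · exact le_of_lt (lt_of_not_ge h3)

/-- **The whisker collapse fixes the reduced spine pointwise.** [folklore] -/
theorem whisker_eq_self (hg : 2 ≤ g) (s : ℝ) {p : 𝔼 3} (hp : p ∈ spineZ' g hg) : whisker hg s p = p := by
  obtain ⟨hp, hle⟩ := hp
  rw [whisker]
  split_ifs with h3 him
  · have heq : ‖proj p‖ = rho3 hg := le_antisymm hle h3
    have hw : whiskerRadius hg s p = rho3 hg := by rw [whiskerRadius, heq]; ring
    rw [hw]
    obtain ⟨-, ⟨-, h⟩ | ⟨him', h⟩⟩ := proj_eq_of_mem_spineZ hg hp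
    · rw [← heq, ← h]; exact (eq_lift_proj_of_mem_spineZ hg hp h3).symm
    · have him0 : (toC (proj p)).im = 0 := le_antisymm him' him
      rw [eq_ptQ_of_mem_spineZ hg hp h3 him0, ptQ, thlo_eq_zero_of_mem hg (rt_seven_lt_rho3 hg).le le_rfl,
        pol_zero_right]
  · have heq : ‖proj p‖ = rho3 hg := le_antisymm hle h3
    have hw : whiskerRadius hg s p = rho3 hg := by rw [whiskerRadius, heq]; ring
    rw [hw]
    obtain ⟨-, ⟨him', h⟩ | ⟨-, h⟩⟩ := proj_eq_of_mem_spineZ hg hp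
    · exact absurd him' him
    · rw [← heq, ← h]; exact (eq_lift_proj_of_mem_spineZ hg hp h3).symm
  · rfl

/-- The spine floor is compact. [folklore] -/
theorem isCompact_spineFloor (hg : 2 ≤ g) : IsCompact (spineFloor g hg) := by
  have h : IsCompact ((fun r => pol r (thlo g r)) '' Icc (rho1 hg) (rho4 hg)) :=
    isCompact_Icc.image_of_continuousOn ((continuousOn_pol_thlo hg).mono fun _ hr =>
      le_trans (rho1_pos hg).le hr.1)
  exact h.union (h.image refl.continuous)

/-- The spine is closed. [folklore] -/
theorem isClosed_spineZ (hg : 2 ≤ g) : IsClosed (spineZ g hg) :=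
  isClosed_double_inter contDiff_flower.continuous (isCompact_spineFloor hg).isClosed

/-- **The whisker collapse is continuous on `[0, 1] × spine`** (pasting three closed pieces: the
reduced spine, where it is the identity, and the two whiskers, where it is given by the two
sliding formulas, which agree at `Q`). [folklore] -/
theorem continuousOn_whisker (hg : 2 ≤ g) :
    ContinuousOn (fun x : ℝ × 𝔼 3 => whisker hg x.1 x.2) (Icc (0 : ℝ) 1 ×ˢ spineZ g hg) := by
  -- the sliding radius is continuous and non-negative on `[0, 1] × ℝ³`
  have hw : Continuous fun x : ℝ × 𝔼 3 => whiskerRadius hg x.1 x.2 := by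
    unfold whiskerRadius; fun_prop
  have hw0 : ∀ x : ℝ × 𝔼 3, x ∈ Icc (0 : ℝ) 1 ×ˢ (univ : Set (𝔼 3)) → 0 ≤ whiskerRadius hg x.1 x.2 := by
    rintro ⟨s, p⟩ ⟨hs, -⟩
    simp only [whiskerRadius]
    have := rho3_pos hg
    nlinarith [hs.1, hs.2, norm_nonneg (proj p)]
  have hth : ContinuousOn (fun x : ℝ × 𝔼 3 => thlo g (whiskerRadius hg x.1 x.2))
      (Icc (0 : ℝ) 1 ×ˢ (univ : Set (𝔼 3))) :=
    (continuousOn_thlo hg).comp hw.continuousOn hw0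
  have hb1 : ContinuousOn (fun x : ℝ × 𝔼 3 =>
      lift (pol (whiskerRadius hg x.1 x.2) (thlo g (whiskerRadius hg x.1 x.2))))
      (Icc (0 : ℝ) 1 ×ˢ (univ : Set (𝔼 3))) := by
    show ContinuousOn (⇑lift ∘ ((fun x : ℝ × ℝ => pol x.1 x.2) ∘ fun x : ℝ × 𝔼 3 =>
      (whiskerRadius hg x.1 x.2, thlo g (whiskerRadius hg x.1 x.2)))) _
    exact lift.continuous.comp_continuousOn (continuous_pol.comp_continuousOn (hw.continuousOn.prodMk hth))
  have hb2 : ContinuousOn (fun x : ℝ × 𝔼 3 =>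
      lift (pol (whiskerRadius hg x.1 x.2) (-thlo g (whiskerRadius hg x.1 x.2))))
      (Icc (0 : ℝ) 1 ×ˢ (univ : Set (𝔼 3))) := by
    show ContinuousOn (⇑lift ∘ ((fun x : ℝ × ℝ => pol x.1 x.2) ∘ fun x : ℝ × 𝔼 3 =>
      (whiskerRadius hg x.1 x.2, -thlo g (whiskerRadius hg x.1 x.2)))) _
    exact lift.continuous.comp_continuousOn (continuous_pol.comp_continuousOn (hw.continuousOn.prodMk hth.neg))
  -- the three closed pieces
  set P₁ : Set (𝔼 3) := spineZ g hg ∩ {p | ‖proj p‖ ≤ rho3 hg} with hP₁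
  set P₂ : Set (𝔼 3) := spineZ g hg ∩ {p | rho3 hg ≤ ‖proj p‖} ∩ {p | 0 ≤ (toC (proj p)).im} with hP₂
  set P₃ : Set (𝔼 3) := spineZ g hg ∩ {p | rho3 hg ≤ ‖proj p‖} ∩ {p | (toC (proj p)).im ≤ 0} with hP₃
  have hnc : Continuous fun p : 𝔼 3 => ‖proj p‖ := continuous_norm.comp proj.continuous
  have hic : Continuous fun p : 𝔼 3 => (toC (proj p)).im :=
    Complex.continuous_im.comp (toC.continuous.comp proj.continuous)
  have hc₁ : IsClosed P₁ := (isClosed_spineZ hg).inter (isClosed_le hnc continuous_const)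
  have hc₂ : IsClosed P₂ :=
    ((isClosed_spineZ hg).inter (isClosed_le continuous_const hnc)).inter (isClosed_le continuous_const hic)
  have hc₃ : IsClosed P₃ :=
    ((isClosed_spineZ hg).inter (isClosed_le continuous_const hnc)).inter (isClosed_le hic continuous_const)
  have hcover : spineZ g hg ⊆ P₁ ∪ P₂ ∪ P₃ := by
    intro p hp
    rcases le_total ‖proj p‖ (rho3 hg) with h | h
    · exact Or.inl (Or.inl ⟨hp, h⟩)
    · rcases le_total 0 (toC (proj p)).im with him | him
      · exact Or.inl (Or.inr ⟨⟨hp, h⟩, him⟩)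
      · exact Or.inr ⟨⟨hp, h⟩, him⟩
  -- the map on each piece
  have h₁ : ContinuousOn (fun x : ℝ × 𝔼 3 => whisker hg x.1 x.2) (Icc (0 : ℝ) 1 ×ˢ P₁) := by
    refine continuousOn_snd.congr ?_
    rintro ⟨s, p⟩ ⟨-, hp⟩
    exact whisker_eq_self hg s hp
  have h₂ : ContinuousOn (fun x : ℝ × 𝔼 3 => whisker hg x.1 x.2) (Icc (0 : ℝ) 1 ×ˢ P₂) := by
    refine (hb1.mono (prod_mono le_rfl (subset_univ _))).congr ?_
    rintro ⟨s, p⟩ ⟨-, ⟨-, h3⟩, him⟩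
    have h3' : rho3 hg ≤ ‖proj p‖ := h3
    have him' : 0 ≤ (toC (proj p)).im := him
    show whisker hg s p = _
    rw [whisker, if_pos h3', if_pos him']
  have h₃ : ContinuousOn (fun x : ℝ × 𝔼 3 => whisker hg x.1 x.2) (Icc (0 : ℝ) 1 ×ˢ P₃) := by
    refine (hb2.mono (prod_mono le_rfl (subset_univ _))).congr ?_
    rintro ⟨s, p⟩ ⟨-, ⟨hp, h3⟩, him⟩
    have h3' : rho3 hg ≤ ‖proj p‖ := h3
    have him' : (toC (proj p)).im ≤ 0 := him
    show whisker hg s p = _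
    show whisker hg s p = lift (pol (whiskerRadius hg s p) (-thlo g (whiskerRadius hg s p)))
    rw [whisker, if_pos h3']
    split_ifs with h0
    · -- `im = 0`: the point is `Q` and the two formulas agree
      have hp' : p ∈ spineZ g hg := hp
      have hQ : p = ptQ hg := eq_ptQ_of_mem_spineZ hg hp' h3' (le_antisymm him' h0)
      have hw' : whiskerRadius hg s p = rho3 hg := by
        rw [whiskerRadius, hQ, ptQ, proj_lift, norm_ax, abs_of_pos (rho3_pos hg)]; ring
      rw [hw', thlo_eq_zero_of_mem hg (rt_seven_lt_rho3 hg).le le_rfl, neg_zero]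
    · rfl
  have hall : ContinuousOn (fun x : ℝ × 𝔼 3 => whisker hg x.1 x.2)
      ((Icc (0 : ℝ) 1 ×ˢ P₁ ∪ Icc (0 : ℝ) 1 ×ˢ P₂) ∪ Icc (0 : ℝ) 1 ×ˢ P₃) :=
    (h₁.union_of_isClosed h₂ (isClosed_Icc.prod hc₁) (isClosed_Icc.prod hc₂)).union_of_isClosed h₃
      ((isClosed_Icc.prod hc₁).union (isClosed_Icc.prod hc₂)) (isClosed_Icc.prod hc₃)
  refine hall.mono ?_
  rintro ⟨s, p⟩ ⟨hs, hp⟩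
  rcases hcover hp with (h | h) | h
  · exact Or.inl (Or.inl ⟨hs, h⟩)
  · exact Or.inl (Or.inr ⟨hs, h⟩)
  · exact Or.inr ⟨hs, h⟩

/-- **The spine strong deformation retracts onto the reduced spine** (whisker collapse). [folklore] -/
theorem spineZ'_isStrongDeformationRetractOf_spineZ (hg : 2 ≤ g) :
    IsStrongDeformationRetractOf (spineZ' g hg) (spineZ g hg) :=
  IsStrongDeformationRetractOf.of_continuousOn (whisker hg) (continuousOn_whisker hg)
    (fun _ hs _ hp => whisker_mem hg hs hp) (fun _ hp => whisker_zero hg hp)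
    (fun _ hp => whisker_one_mem hg hp) (fun s _ _ _ hpK => whisker_eq_self hg s hpK)

/-- **The sector of the flower surface strong deformation retracts onto the reduced spine
`L ∪ m⁺ ∪ m⁻`.** [folklore] -/
theorem spineZ'_isStrongDeformationRetractOf_sectorZ (hg : 2 ≤ g) :
    IsStrongDeformationRetractOf (spineZ' g hg) (sectorZ g) :=
  (spineZ_isStrongDeformationRetractOf_sectorZ hg).trans (spineZ'_isStrongDeformationRetractOf_spineZ hg)
    ((inter_subset_inter_right _ (preimage_mono (spineFloor_subset hg))).trans
      (inter_subset_inter_right _ (preimage_mono (floorSetW_subset_wedge hg))))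
    inter_subset_left

end FlowerModel

end Literature.Topology.FourManifolds
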